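import Mathlib
import Summits.Ventures.PercRepro2.K5StarCertTA
import Summits.Ventures.PercRepro2.K5StarCertTB
import Summits.Ventures.PercRepro2.K5StarCertM1
import Summits.Ventures.PercRepro2.K5StarCertM2
import Summits.Ventures.PercRepro2.K5StarCertM3
import Summits.Ventures.PercRepro2.K5StarCertB1
import Summits.Ventures.PercRepro2.K5StarCertB2
import Summits.Ventures.PercRepro2.K5StarBridge
import Summits.Ventures.PercRepro2.K5StarSymm
import Summits.Ventures.PercRepro2.TypedStarCore

/-!
# THE `K₅` STAR CERTIFICATES ARE THEOREMS: `StarCerts R` HOLDS, AND THE ONE-STAR CLASS IS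
UNCONDITIONAL (blind cell PercRepro2, p2 g2 / g5, 2026-08-25; sub-claim S1 (C) closed — ONE module
for the olean lane: p2 g2's K5StarSorted.lean, K5StarDispatch4 / 3 / 0.lean and K5StarAll.lean)

1. **The eleven sorted neighbourhoods** (`starNonneg_b{b}_{T}`): for each `(marking, sorted
   neighbourhood)` the core needs, the six kernel certificates give the five certified pieces
   (`starCerts5_of_certLE`), the multigraph pieces are theorems (`starPieces_of_certs5`), and the
   placement sums are nonnegative at every type vector (`starNonneg_of_pieces`).
2. **The dispatch over the marks** (`NbQ`, `starNonneg_sorted_4 / _3 / _0`): the 125 cases of the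
   three sorted marks, each either a violated order, a second root, or one of the eleven.
3. **The closure**: the symmetry of the placement sum (`starNonneg_of_sorted`, K5StarSymm.lean)
   extends the sorted neighbourhoods to every ordering — **`starCerts_holds : StarCerts R`** and
   **`HCov_all_of_residualCoreS_all' : ResidualCoreS_all R → HCov_all R`**: the crux of record from
   row 2′TRI on the core WITHOUT a root cut and WITHOUT a one-star of degree `3`, UNCONDITIONALLY; in
   particular the named `(6, 7)` target is closed.

Own code; standard axioms (the certificates are `decide +kernel`).
-/

namespace Summit.Ventures.PercRepro2

open Hub

namespace K5

/-! ## The eleven sorted neighbourhoods -/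

section Sorted

variable {R : Type*} [Field R] [LinearOrder R] [IsStrictOrderedRing R]

/-- The sorted neighbourhood `T = {0, 1, 3}` at the marking `(0, 1, 2, 3, 4)`. -/
theorem starNonneg_b4_013 (t₁ t₂ t₃ : ℕ) (h1 : t₁ = 1 ∨ t₁ = 2) (h2 : t₂ = 1 ∨ t₂ = 2) (h3 : t₃ = 1 ∨ t₃ = 2) :
    StarNonneg R 0 1 2 3 4 0 1 3 t₁ t₂ t₃ :=
  starNonneg_of_pieces (starPieces_of_certs5 4 (by decide) (by decide) (by decide) (by decide)
    (by decide) (by decide) (by decide)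
    (starCerts5_of_certLE 4 4 (by decide) 0 1 3 0 1 3 (by decide) (by decide) (by decide) (pairMask 0 1) (Or.inl rfl)
      cert_K3T1_b4_013 cert_K3T2_b4_013 cert_K3M_b4_013_01
      cert_K3M_b4_013_03 cert_K3M_b4_013_13
      cert_K3B_b4_013_01)) t₁ t₂ t₃ h1 h2 h3

/-- The sorted neighbourhood `T = {0, 1, 4}` at the marking `(0, 1, 2, 3, 4)`. -/
theorem starNonneg_b4_014 (t₁ t₂ t₃ : ℕ) (h1 : t₁ = 1 ∨ t₁ = 2) (h2 : t₂ = 1 ∨ t₂ = 2) (h3 : t₃ = 1 ∨ t₃ = 2) :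
    StarNonneg R 0 1 2 3 4 0 1 4 t₁ t₂ t₃ :=
  starNonneg_of_pieces (starPieces_of_certs5 4 (by decide) (by decide) (by decide) (by decide)
    (by decide) (by decide) (by decide)
    (starCerts5_of_certLE 4 4 (by decide) 0 1 4 0 1 4 (by decide) (by decide) (by decide) (pairMask 0 4) (Or.inr (Or.inl rfl))
      cert_K3T1_b4_014 cert_K3T2_b4_014 cert_K3M_b4_014_01
      cert_K3M_b4_014_04 cert_K3M_b4_014_14
      cert_K3B_b4_014_04)) t₁ t₂ t₃ h1 h2 h3

/-- The sorted neighbourhood `T = {0, 2, 3}` at the marking `(0, 1, 2, 3, 4)`. -/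
theorem starNonneg_b4_023 (t₁ t₂ t₃ : ℕ) (h1 : t₁ = 1 ∨ t₁ = 2) (h2 : t₂ = 1 ∨ t₂ = 2) (h3 : t₃ = 1 ∨ t₃ = 2) :
    StarNonneg R 0 1 2 3 4 0 2 3 t₁ t₂ t₃ :=
  starNonneg_of_pieces (starPieces_of_certs5 4 (by decide) (by decide) (by decide) (by decide)
    (by decide) (by decide) (by decide)
    (starCerts5_of_certLE 4 4 (by decide) 0 2 3 0 2 3 (by decide) (by decide) (by decide) (pairMask 0 2) (Or.inl rfl)
      cert_K3T1_b4_023 cert_K3T2_b4_023 cert_K3M_b4_023_02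
      cert_K3M_b4_023_03 cert_K3M_b4_023_23
      cert_K3B_b4_023_02)) t₁ t₂ t₃ h1 h2 h3

/-- The sorted neighbourhood `T = {0, 2, 4}` at the marking `(0, 1, 2, 3, 4)`. -/
theorem starNonneg_b4_024 (t₁ t₂ t₃ : ℕ) (h1 : t₁ = 1 ∨ t₁ = 2) (h2 : t₂ = 1 ∨ t₂ = 2) (h3 : t₃ = 1 ∨ t₃ = 2) :
    StarNonneg R 0 1 2 3 4 0 2 4 t₁ t₂ t₃ :=
  starNonneg_of_pieces (starPieces_of_certs5 4 (by decide) (by decide) (by decide) (by decide)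
    (by decide) (by decide) (by decide)
    (starCerts5_of_certLE 4 4 (by decide) 0 2 4 0 2 4 (by decide) (by decide) (by decide) (pairMask 0 4) (Or.inr (Or.inl rfl))
      cert_K3T1_b4_024 cert_K3T2_b4_024 cert_K3M_b4_024_02
      cert_K3M_b4_024_04 cert_K3M_b4_024_24
      cert_K3B_b4_024_04)) t₁ t₂ t₃ h1 h2 h3

/-- The sorted neighbourhood `T = {0, 3, 4}` at the marking `(0, 1, 2, 3, 4)`. -/
theorem starNonneg_b4_034 (t₁ t₂ t₃ : ℕ) (h1 : t₁ = 1 ∨ t₁ = 2) (h2 : t₂ = 1 ∨ t₂ = 2) (h3 : t₃ = 1 ∨ t₃ = 2) :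
    StarNonneg R 0 1 2 3 4 0 3 4 t₁ t₂ t₃ :=
  starNonneg_of_pieces (starPieces_of_certs5 4 (by decide) (by decide) (by decide) (by decide)
    (by decide) (by decide) (by decide)
    (starCerts5_of_certLE 4 4 (by decide) 0 3 4 0 3 4 (by decide) (by decide) (by decide) (pairMask 0 4) (Or.inr (Or.inl rfl))
      cert_K3T1_b4_034 cert_K3T2_b4_034 cert_K3M_b4_034_03
      cert_K3M_b4_034_04 cert_K3M_b4_034_34
      cert_K3B_b4_034_04)) t₁ t₂ t₃ h1 h2 h3

/-- The sorted neighbourhood `T = {1, 3, 4}` at the marking `(0, 1, 2, 3, 4)`. -/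
theorem starNonneg_b4_134 (t₁ t₂ t₃ : ℕ) (h1 : t₁ = 1 ∨ t₁ = 2) (h2 : t₂ = 1 ∨ t₂ = 2) (h3 : t₃ = 1 ∨ t₃ = 2) :
    StarNonneg R 0 1 2 3 4 1 3 4 t₁ t₂ t₃ :=
  starNonneg_of_pieces (starPieces_of_certs5 4 (by decide) (by decide) (by decide) (by decide)
    (by decide) (by decide) (by decide)
    (starCerts5_of_certLE 4 4 (by decide) 1 3 4 1 3 4 (by decide) (by decide) (by decide) (pairMask 1 4) (Or.inr (Or.inl rfl))
      cert_K3T1_b4_134 cert_K3T2_b4_134 cert_K3M_b4_134_13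
      cert_K3M_b4_134_14 cert_K3M_b4_134_34
      cert_K3B_b4_134_14)) t₁ t₂ t₃ h1 h2 h3

/-- The sorted neighbourhood `T = {2, 3, 4}` at the marking `(0, 1, 2, 3, 4)`. -/
theorem starNonneg_b4_234 (t₁ t₂ t₃ : ℕ) (h1 : t₁ = 1 ∨ t₁ = 2) (h2 : t₂ = 1 ∨ t₂ = 2) (h3 : t₃ = 1 ∨ t₃ = 2) :
    StarNonneg R 0 1 2 3 4 2 3 4 t₁ t₂ t₃ :=
  starNonneg_of_pieces (starPieces_of_certs5 4 (by decide) (by decide) (by decide) (by decide)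
    (by decide) (by decide) (by decide)
    (starCerts5_of_certLE 4 4 (by decide) 2 3 4 2 3 4 (by decide) (by decide) (by decide) (pairMask 2 4) (Or.inr (Or.inl rfl))
      cert_K3T1_b4_234 cert_K3T2_b4_234 cert_K3M_b4_234_23
      cert_K3M_b4_234_24 cert_K3M_b4_234_34
      cert_K3B_b4_234_24)) t₁ t₂ t₃ h1 h2 h3

/-- The sorted neighbourhood `T = {0, 1, 3}` at the marking `(0, 1, 2, 3, 3)`. -/
theorem starNonneg_b3_013 (t₁ t₂ t₃ : ℕ) (h1 : t₁ = 1 ∨ t₁ = 2) (h2 : t₂ = 1 ∨ t₂ = 2) (h3 : t₃ = 1 ∨ t₃ = 2) :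
    StarNonneg R 0 1 2 3 3 0 1 3 t₁ t₂ t₃ :=
  starNonneg_of_pieces (starPieces_of_certs5 3 (by decide) (by decide) (by decide) (by decide)
    (by decide) (by decide) (by decide)
    (starCerts5_of_certLE 3 3 (by decide) 0 1 3 0 1 3 (by decide) (by decide) (by decide) (pairMask 0 1) (Or.inl rfl)
      cert_K3T1_b3_013 cert_K3T2_b3_013 cert_K3M_b3_013_01
      cert_K3M_b3_013_03 cert_K3M_b3_013_13
      cert_K3B_b3_013_01)) t₁ t₂ t₃ h1 h2 h3

/-- The sorted neighbourhood `T = {0, 2, 3}` at the marking `(0, 1, 2, 3, 3)`. -/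
theorem starNonneg_b3_023 (t₁ t₂ t₃ : ℕ) (h1 : t₁ = 1 ∨ t₁ = 2) (h2 : t₂ = 1 ∨ t₂ = 2) (h3 : t₃ = 1 ∨ t₃ = 2) :
    StarNonneg R 0 1 2 3 3 0 2 3 t₁ t₂ t₃ :=
  starNonneg_of_pieces (starPieces_of_certs5 3 (by decide) (by decide) (by decide) (by decide)
    (by decide) (by decide) (by decide)
    (starCerts5_of_certLE 3 3 (by decide) 0 2 3 0 2 3 (by decide) (by decide) (by decide) (pairMask 0 2) (Or.inl rfl)
      cert_K3T1_b3_023 cert_K3T2_b3_023 cert_K3M_b3_023_02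
      cert_K3M_b3_023_03 cert_K3M_b3_023_23
      cert_K3B_b3_023_02)) t₁ t₂ t₃ h1 h2 h3

/-- The sorted neighbourhood `T = {0, 1, 3}` at the marking `(0, 1, 2, 3, 0)`. -/
theorem starNonneg_b0_013 (t₁ t₂ t₃ : ℕ) (h1 : t₁ = 1 ∨ t₁ = 2) (h2 : t₂ = 1 ∨ t₂ = 2) (h3 : t₃ = 1 ∨ t₃ = 2) :
    StarNonneg R 0 1 2 3 0 0 1 3 t₁ t₂ t₃ :=
  starNonneg_of_pieces (starPieces_of_certs5 0 (by decide) (by decide) (by decide) (by decide)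
    (by decide) (by decide) (by decide)
    (starCerts5_of_certLE 0 0 (by decide) 0 1 3 0 1 3 (by decide) (by decide) (by decide) (pairMask 0 1) (Or.inl rfl)
      cert_K3T1_b0_013 cert_K3T2_b0_013 cert_K3M_b0_013_01
      cert_K3M_b0_013_03 cert_K3M_b0_013_13
      cert_K3B_b0_013_01)) t₁ t₂ t₃ h1 h2 h3

/-- The sorted neighbourhood `T = {0, 2, 3}` at the marking `(0, 1, 2, 3, 0)`. -/
theorem starNonneg_b0_023 (t₁ t₂ t₃ : ℕ) (h1 : t₁ = 1 ∨ t₁ = 2) (h2 : t₂ = 1 ∨ t₂ = 2) (h3 : t₃ = 1 ∨ t₃ = 2) :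
    StarNonneg R 0 1 2 3 0 0 2 3 t₁ t₂ t₃ :=
  starNonneg_of_pieces (starPieces_of_certs5 0 (by decide) (by decide) (by decide) (by decide)
    (by decide) (by decide) (by decide)
    (starCerts5_of_certLE 0 0 (by decide) 0 2 3 0 2 3 (by decide) (by decide) (by decide) (pairMask 0 2) (Or.inl rfl)
      cert_K3T1_b0_023 cert_K3T2_b0_023 cert_K3M_b0_023_02
      cert_K3M_b0_023_03 cert_K3M_b0_023_23
      cert_K3B_b0_023_02)) t₁ t₂ t₃ h1 h2 h3

end Sorted

/-! ## The dispatch over the marks -/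

section Dispatch

variable (R : Type*) [Field R] [LinearOrder R] [IsStrictOrderedRing R]

/-- The neighbourhood family: marks of the marking `(0, 1, 2, 3, b)`, at most one root. -/
def NbQ (b : Fin 5) (x y z : Fin 5) : Prop :=
  (x = 0 ∨ x = 1 ∨ x = 2 ∨ x = 3 ∨ x = b) ∧ (y = 0 ∨ y = 1 ∨ y = 2 ∨ y = 3 ∨ y = b) ∧
    (z = 0 ∨ z = 1 ∨ z = 2 ∨ z = 3 ∨ z = b) ∧ ¬ ((x = 1 ∨ y = 1 ∨ z = 1) ∧ (x = 2 ∨ y = 2 ∨ z = 2))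

/-- **Every sorted neighbourhood at the marking `(0, 1, 2, 3, 4)` is certified** (the 125 cases of the
three sorted marks: the vacuous ones — a violated order or a second root — by `decide`, the rest the
certified neighbourhoods in order). -/
theorem starNonneg_sorted_4 (q₁ q₂ q₃ : Fin 5) (hq : NbQ 4 q₁ q₂ q₃) (h12 : q₁ < q₂) (h23 : q₂ < q₃)
    (t₁ t₂ t₃ : ℕ) (ht₁ : t₁ = 1 ∨ t₁ = 2) (ht₂ : t₂ = 1 ∨ t₂ = 2) (ht₃ : t₃ = 1 ∨ t₃ = 2) :
    StarNonneg R 0 1 2 3 4 q₁ q₂ q₃ t₁ t₂ t₃ := by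
  obtain ⟨hq₁, hq₂, hq₃, hroot⟩ := hq
  rcases hq₁ with rfl | rfl | rfl | rfl | rfl <;> rcases hq₂ with rfl | rfl | rfl | rfl | rfl <;>
  rcases hq₃ with rfl | rfl | rfl | rfl | rfl <;>
  first | (exfalso; revert h12 h23 hroot; decide) | skip
  exacts [starNonneg_b4_013 t₁ t₂ t₃ ht₁ ht₂ ht₃,
    starNonneg_b4_014 t₁ t₂ t₃ ht₁ ht₂ ht₃,
    starNonneg_b4_023 t₁ t₂ t₃ ht₁ ht₂ ht₃,
    starNonneg_b4_024 t₁ t₂ t₃ ht₁ ht₂ ht₃,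
    starNonneg_b4_034 t₁ t₂ t₃ ht₁ ht₂ ht₃,
    starNonneg_b4_134 t₁ t₂ t₃ ht₁ ht₂ ht₃,
    starNonneg_b4_234 t₁ t₂ t₃ ht₁ ht₂ ht₃]

/-- **Every sorted neighbourhood at the marking `(0, 1, 2, 3, 3)` is certified** (the 125 cases of the
three sorted marks: the vacuous ones — a violated order or a second root — by `decide`, the rest the
certified neighbourhoods in order). -/
theorem starNonneg_sorted_3 (q₁ q₂ q₃ : Fin 5) (hq : NbQ 3 q₁ q₂ q₃) (h12 : q₁ < q₂) (h23 : q₂ < q₃)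
    (t₁ t₂ t₃ : ℕ) (ht₁ : t₁ = 1 ∨ t₁ = 2) (ht₂ : t₂ = 1 ∨ t₂ = 2) (ht₃ : t₃ = 1 ∨ t₃ = 2) :
    StarNonneg R 0 1 2 3 3 q₁ q₂ q₃ t₁ t₂ t₃ := by
  obtain ⟨hq₁, hq₂, hq₃, hroot⟩ := hq
  rcases hq₁ with rfl | rfl | rfl | rfl | rfl <;> rcases hq₂ with rfl | rfl | rfl | rfl | rfl <;>
  rcases hq₃ with rfl | rfl | rfl | rfl | rfl <;>
  first | (exfalso; revert h12 h23 hroot; decide) | skip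
  exacts [starNonneg_b3_013 t₁ t₂ t₃ ht₁ ht₂ ht₃,
    starNonneg_b3_013 t₁ t₂ t₃ ht₁ ht₂ ht₃,
    starNonneg_b3_023 t₁ t₂ t₃ ht₁ ht₂ ht₃,
    starNonneg_b3_023 t₁ t₂ t₃ ht₁ ht₂ ht₃]

/-- **Every sorted neighbourhood at the marking `(0, 1, 2, 3, 0)` is certified** (the 125 cases of the
three sorted marks: the vacuous ones — a violated order or a second root — by `decide`, the rest the
certified neighbourhoods in order). -/
theorem starNonneg_sorted_0 (q₁ q₂ q₃ : Fin 5) (hq : NbQ 0 q₁ q₂ q₃) (h12 : q₁ < q₂) (h23 : q₂ < q₃)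
    (t₁ t₂ t₃ : ℕ) (ht₁ : t₁ = 1 ∨ t₁ = 2) (ht₂ : t₂ = 1 ∨ t₂ = 2) (ht₃ : t₃ = 1 ∨ t₃ = 2) :
    StarNonneg R 0 1 2 3 0 q₁ q₂ q₃ t₁ t₂ t₃ := by
  obtain ⟨hq₁, hq₂, hq₃, hroot⟩ := hq
  rcases hq₁ with rfl | rfl | rfl | rfl | rfl <;> rcases hq₂ with rfl | rfl | rfl | rfl | rfl <;>
  rcases hq₃ with rfl | rfl | rfl | rfl | rfl <;>
  first | (exfalso; revert h12 h23 hroot; decide) | skip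
  exacts [starNonneg_b0_013 t₁ t₂ t₃ ht₁ ht₂ ht₃,
    starNonneg_b0_023 t₁ t₂ t₃ ht₁ ht₂ ht₃,
    starNonneg_b0_013 t₁ t₂ t₃ ht₁ ht₂ ht₃,
    starNonneg_b0_023 t₁ t₂ t₃ ht₁ ht₂ ht₃]

end Dispatch

/-! ## The closure -/

section All

variable (R : Type*) [Field R] [LinearOrder R] [IsStrictOrderedRing R]

/-- The neighbourhood family is symmetric in its first two marks. -/
lemma nbQ_swap12 (b : Fin 5) (x y z : Fin 5) (h : NbQ b x y z) : NbQ b y x z := by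
  obtain ⟨h1, h2, h3, h4⟩ := h
  exact ⟨h2, h1, h3, fun hc => h4 ⟨or_left_comm.1 hc.1, or_left_comm.1 hc.2⟩⟩

/-- The neighbourhood family is symmetric in its last two marks. -/
lemma nbQ_swap23 (b : Fin 5) (x y z : Fin 5) (h : NbQ b x y z) : NbQ b x z y := by
  obtain ⟨h1, h2, h3, h4⟩ := h
  exact ⟨h1, h3, h2, fun hc => h4 ⟨(or_congr_right or_comm).1 hc.1, (or_congr_right or_comm).1 hc.2⟩⟩

/-- **Every sorted neighbourhood of the family is certified** (the three markings). -/
theorem starNonneg_sorted (b : Fin 5) (hb : b = 4 ∨ b = 3 ∨ b = 0) (q₁ q₂ q₃ : Fin 5)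
    (hq : NbQ b q₁ q₂ q₃) (h12 : q₁ < q₂) (h23 : q₂ < q₃) (t₁ t₂ t₃ : ℕ) (ht₁ : t₁ = 1 ∨ t₁ = 2)
    (ht₂ : t₂ = 1 ∨ t₂ = 2) (ht₃ : t₃ = 1 ∨ t₃ = 2) : StarNonneg R 0 1 2 3 b q₁ q₂ q₃ t₁ t₂ t₃ := by
  rcases hb with rfl | rfl | rfl
  · exact starNonneg_sorted_4 R q₁ q₂ q₃ hq h12 h23 t₁ t₂ t₃ ht₁ ht₂ ht₃
  · exact starNonneg_sorted_3 R q₁ q₂ q₃ hq h12 h23 t₁ t₂ t₃ ht₁ ht₂ ht₃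
  · exact starNonneg_sorted_0 R q₁ q₂ q₃ hq h12 h23 t₁ t₂ t₃ ht₁ ht₂ ht₃

/-- **THE `K₅` STAR CERTIFICATES HOLD.** -/
theorem starCerts_holds : CovForm.TypedRed.StarCerts R := by
  intro b hb p₁ p₂ p₃ hp t₁ t₂ t₃ ht₁ ht₂ ht₃
  obtain ⟨hp₁, hp₂, hp₃, h12, h13, h23, hroot⟩ := hp
  exact starNonneg_of_sorted (NbQ b) (nbQ_swap12 b) (nbQ_swap23 b)
    (fun q₁ q₂ q₃ hq h12 h23 => starNonneg_sorted R b hb q₁ q₂ q₃ hq h12 h23) p₁ p₂ p₃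
    ⟨hp₁, hp₂, hp₃, hroot⟩ h12 h13 h23 t₁ t₂ t₃ ht₁ ht₂ ht₃

/-- **THE CRUX OF RECORD FROM (TRI) ON THE CORE WITHOUT A ROOT CUT AND WITHOUT A ONE-STAR OF
DEGREE `3`** — unconditional. -/
theorem HCov_all_of_residualCoreS_all' (hc : CovForm.TypedRed.ResidualCoreS_all R) : CovForm.HCov_all R :=
  CovForm.TypedRed.HCov_all_of_residualCoreS_all R (starCerts_holds R) hc

end All

end K5

end Summit.Ventures.PercRepro2
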